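import Summits.ValiantsHypothesis.ValiantsHypothesis.Theorems.VPBoundarySquareKroneckerVNP
import Literature.Computability.AlgebraicComplexity.Bur26CountingClassVCH
import Literature.Computability.Complexity.PPolyReductions
import Literature.Computability.Complexity.PolyAdviceClosure
import Literature.Computability.Complexity.CodeFPBudgets
import HarnessLib

/-!
# `P/poly` translation of the `VCH⁰` coefficient queries into Tavenas' univariate queries

Route-independent Boolean side of the `VPBoundarySquare` `CH`-corner
(`Theorems/VPBoundarySquareCHAlgebraicHalf.lean`).  Bürgisser's coefficient-function
languages answer the multivariate queries `expCoeffQuery n e a = ⟨1ⁿ, ⟨encMonomial e, bin a⟩⟩`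
(`Literature/…/Bur26CountingClassVCH.lean`); Tavenas' `VNP`-witness reads the univariate
queries `encUQuery n α j = ⟨1ⁿ, ⟨bin α, bin j⟩⟩` of the Kronecker-packed family.  The
translation `α ↦ sparse base-2^δ digit list of α` is written as a program in the tree's `CodeFP`
combinator DSL (`codeFP_tr`: advice-table lookup of `(uₙ, δₙ)`, digit extraction with
`natPow/natDiv/natMod`, `map` over `range uₙ`, sparse `filter`), hence lies in `FP`; the
non-uniform arities `(uₙ, δₙ)` are supplied as polynomial advice, and `P/poly` is closed under
both (`preimage_mem_PPoly`, `polyAdvice_PPoly_subset_PPoly`).  Indices `α ≥ 2^{δu}` are sent to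
the query `(n, 0, 2^δ)`, false for every family whose coefficients have absolute value
`< 2^{2^δ⁻¹}` — this is what makes the uncomputable arity harmless
(`exists_encUQuery_language`).

[cite: Burgisser2026HNC, Def. 4.2 and Lemma 4.11 (pp. 11–13)] [cite: Tavenas2014, Prop. 3.17]
-/

noncomputable section

set_option linter.dupNamespace false

open MvPolynomial
open Literature.Computability.AlgebraicComplexity
open Literature.Computability.Complexity

namespace Summit.ValiantsHypothesis.ValiantsHypothesis.Theorems.VPBoundarySquareCoeffQueryFP

open Summit.ValiantsHypothesis.ValiantsHypothesis.Theorems.VPBoundarySquareKroneckerVNP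

/-! ## §4  Boolean re-encoding: from `expCoeffQuery` to `encUQuery` -/

section BooleanSide

open CodeFP

/-- `sbit` of a coefficient is the coefficient bit function. -/
theorem sbit_coeff_eq_coeffFnBit {u : ℕ} (f : MvPolynomial (Fin u) ℤ) (e : Fin u →₀ ℕ) (j : ℕ) :
    sbit (coeff e f) j = coeffFnBit f e j := by
  cases j <;> rfl

/-- The sparse digit list the translation program computes. -/
def digitsL (uu dd α : ℕ) : List (ℕ × ℕ) :=
  ((List.range uu).map fun i => (i, α / (2 ^ dd) ^ (min i uu) % 2 ^ dd)).filter
    fun q => !decide (q.2 = 0)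

/-- The translation on decoded data: `((n, α, j), table) ↦ (n, sparse base-2^δ digits of α, j)`
with `(u, δ)` read off row `n` of the table; out-of-range indices `α ≥ 2^{δu}` are sent to the
query `(n, 0, 2^δ)`, which is false for every family of the format at hand. -/
def tr (t : (ℕ × (ℕ × ℕ)) × List (List ℕ)) : ℕ × (List (ℕ × ℕ) × ℕ) :=
  if decide (t.1.2.1 < (2 ^ (t.2.getD t.1.1 []).getD 1 0) ^ (t.2.getD t.1.1 []).getD 0 0) = true
  then (t.1.1, (digitsL ((t.2.getD t.1.1 []).getD 0 0) ((t.2.getD t.1.1 []).getD 1 0) t.1.2.1,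
    t.1.2.2))
  else (t.1.1, (([] : List (ℕ × ℕ)), 2 ^ (t.2.getD t.1.1 []).getD 1 0))

/-- Input code `⟨⟨1ⁿ, ⟨bin α, bin j⟩⟩, table⟩` (the `encUQuery` word paired with the advice). -/
abbrev eIn : (ℕ × (ℕ × ℕ)) × List (List ℕ) → List Bool :=
  pairE (pairE unE (pairE natE natE)) (rawE (rawE unE))

/-- Output code `⟨1ⁿ, ⟨sparse monomial code, bin a⟩⟩` (the `expCoeffQuery` format). -/
abbrev eOut : ℕ × (List (ℕ × ℕ) × ℕ) → List Bool :=
  pairE unE (pairE (listE (pairE natE natE)) natE)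

/-- The translation is polynomial-time computable on codes (a `CodeFP` program). -/
theorem codeFP_tr : CodeFP eIn eOut tr := by
  have h_n : CodeFP eIn unE (fun t => t.1.1) :=
    (CodeFP.fst (pairE unE (pairE natE natE)) (rawE (rawE unE))).fst'
  have h_nN : CodeFP eIn natE (fun t => t.1.1) := (natOfUn.comp h_n).congr fun _ => rfl
  have h_α : CodeFP eIn natE (fun t => t.1.2.1) :=
    (CodeFP.fst (pairE unE (pairE natE natE)) (rawE (rawE unE))).snd'.fst'
  have h_j : CodeFP eIn natE (fun t => t.1.2.2) :=
    (CodeFP.fst (pairE unE (pairE natE natE)) (rawE (rawE unE))).snd'.snd'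
  have h_T : CodeFP eIn (rawE (rawE unE)) (fun t => t.2) :=
    CodeFP.snd (pairE unE (pairE natE natE)) (rawE (rawE unE))
  have h_row : CodeFP eIn (rawE unE) (fun t => t.2.getD t.1.1 []) :=
    ((rawGetD (rawE unE) (d := ([] : List ℕ)) rfl).comp (h_T.pair h_nN)).congr fun _ => rfl
  have h_u : CodeFP eIn unE (fun t => (t.2.getD t.1.1 []).getD 0 0) :=
    ((rawGetD unE (d := 0) rfl).comp (h_row.pair (const eIn (eβ := natE) 0))).congr fun _ => rfl
  have h_δ : CodeFP eIn unE (fun t => (t.2.getD t.1.1 []).getD 1 0) :=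
    ((rawGetD unE (d := 0) rfl).comp (h_row.pair (const eIn (eβ := natE) 1))).congr fun _ => rfl
  have h_D : CodeFP eIn natE (fun t => 2 ^ (t.2.getD t.1.1 []).getD 1 0) :=
    (natPow.comp ((const eIn (eβ := natE) 2).pair h_δ)).congr fun _ => rfl
  have h_Du : CodeFP eIn natE
      (fun t => (2 ^ (t.2.getD t.1.1 []).getD 1 0) ^ (t.2.getD t.1.1 []).getD 0 0) :=
    (natPow.comp (h_D.pair h_u)).congr fun _ => rfl
  have h_lt : CodeFP eIn bitE (fun t =>
      decide (t.1.2.1 < (2 ^ (t.2.getD t.1.1 []).getD 1 0) ^ (t.2.getD t.1.1 []).getD 0 0)) :=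
    (natLt.comp (h_α.pair h_Du)).congr fun _ => rfl
  -- digit extraction, mapped over `range u` in the context `(α, (2^δ, u))`
  let eC : ℕ × (ℕ × ℕ) → List Bool := pairE natE (pairE natE unE)
  have hi : CodeFP (pairE eC natE) natE (fun q => q.2) := CodeFP.snd eC natE
  have hcα : CodeFP (pairE eC natE) natE (fun q => q.1.1) := (CodeFP.fst eC natE).fst'
  have hcD : CodeFP (pairE eC natE) natE (fun q => q.1.2.1) := (CodeFP.fst eC natE).snd'.fst'
  have hcu : CodeFP (pairE eC natE) unE (fun q => q.1.2.2) := (CodeFP.fst eC natE).snd'.snd'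
  have hdig : CodeFP (pairE eC natE) natE
      (fun q => q.1.1 / q.1.2.1 ^ (min q.2 q.1.2.2) % q.1.2.1) :=
    (natMod.comp ((natDiv.comp (hcα.pair (natPow.comp (hcD.pair
      (unOfNatMin.comp (hcu.pair hi)))))).pair hcD)).congr fun _ => rfl
  have hmap : CodeFP (pairE eC (rawE natE)) (rawE (pairE natE natE))
      (fun p => p.2.map fun i => (i, p.1.1 / p.1.2.1 ^ (min i p.1.2.2) % p.1.2.1)) :=
    (CodeFP.map (hi.pair hdig)).congr fun _ => rfl
  have h_digs0 : CodeFP eIn (rawE (pairE natE natE)) (fun t =>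
      (List.range ((t.2.getD t.1.1 []).getD 0 0)).map fun i =>
        (i, t.1.2.1 / (2 ^ (t.2.getD t.1.1 []).getD 1 0) ^ (min i ((t.2.getD t.1.1 []).getD 0 0)) %
          2 ^ (t.2.getD t.1.1 []).getD 1 0)) :=
    (hmap.comp ((h_α.pair (h_D.pair h_u)).pair (urange.comp h_u))).congr fun _ => rfl
  have hpf : CodeFP (pairE eIn (pairE natE natE)) bitE (fun q => !decide (q.2.2 = 0)) :=
    (natEq.comp ((CodeFP.snd eIn (pairE natE natE)).snd'.pair
      (const (pairE eIn (pairE natE natE)) (eβ := natE) 0))).not.congr fun _ => rfl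
  have h_digs : CodeFP eIn (listE (pairE natE natE)) (fun t =>
      digitsL ((t.2.getD t.1.1 []).getD 0 0) ((t.2.getD t.1.1 []).getD 1 0) t.1.2.1) :=
    ((listOfRaw (pairE natE natE)).comp
      ((CodeFP.filter hpf).comp ((CodeFP.id eIn).pair h_digs0))).congr fun _ => rfl
  have h_then : CodeFP eIn eOut (fun t => (t.1.1, (digitsL ((t.2.getD t.1.1 []).getD 0 0)
      ((t.2.getD t.1.1 []).getD 1 0) t.1.2.1, t.1.2.2))) := h_n.pair (h_digs.pair h_j)
  have h_else : CodeFP eIn eOut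
      (fun t => (t.1.1, (([] : List (ℕ × ℕ)), 2 ^ (t.2.getD t.1.1 []).getD 1 0))) :=
    h_n.pair ((const eIn (eβ := listE (pairE natE natE)) []).pair h_D)
  exact (h_lt.ite h_then h_else).congr fun t => rfl

/-- The advice table `[[u 0, δ 0], …, [u ℓ, δ ℓ]]`. -/
def table (u δ : ℕ → ℕ) (ℓ : ℕ) : List (List ℕ) := (List.range (ℓ + 1)).map fun i => [u i, δ i]

/-- Its code, the advice string at length `ℓ`. -/
def tableCode (u δ : ℕ → ℕ) (ℓ : ℕ) : List Bool := rawE (rawE unE) (table u δ ℓ)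

/-- Row `n ≤ ℓ` of the advice table. -/
theorem table_getD (u δ : ℕ → ℕ) {ℓ n : ℕ} (h : n ≤ ℓ) : (table u δ ℓ).getD n [] = [u n, δ n] := by
  simp [table, List.getD_eq_getElem?_getD, List.getElem?_range (Nat.lt_succ_of_le h)]

/-- The advice string has polynomial length. -/
theorem length_tableCode_le (u δ : ℕ → ℕ) (PB : Polynomial ℕ) (hu : ∀ n, u n ≤ PB.eval n)
    (hδ : ∀ n, δ n ≤ PB.eval n) (ℓ : ℕ) :
    (tableCode u δ ℓ).length ≤ (ℓ + 1) * (8 * PB.eval ℓ + 10) := by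
  rw [tableCode, length_rawE]
  have hrow : ∀ i ∈ List.range (ℓ + 1), 2 * (rawE unE [u i, δ i]).length + 2 ≤ 8 * PB.eval ℓ + 10 := by
    intro i hi
    have hi' : i ≤ ℓ := Nat.lt_succ_iff.mp (List.mem_range.mp hi)
    have h1 := (hu i).trans (TM2Iter.eval_mono PB hi')
    have h2 := (hδ i).trans (TM2Iter.eval_mono PB hi')
    rw [length_rawE]
    simp only [List.map_cons, List.map_nil, List.sum_cons, List.sum_nil, length_unE]
    omega
  calc ((table u δ ℓ).map fun a => 2 * (rawE unE a).length + 2).sum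
      ≤ ((table u δ ℓ).map fun a => 2 * (rawE unE a).length + 2).length • (8 * PB.eval ℓ + 10) :=
        List.sum_le_card_nsmul _ _ (by
          intro x hx
          rw [table, List.map_map, List.mem_map] at hx
          obtain ⟨i, hi, rfl⟩ := hx
          exact hrow i hi)
    _ = (ℓ + 1) * (8 * PB.eval ℓ + 10) := by simp [table]

/-- `Encodable.encode` on `Fin u` is the value. -/
theorem encode_fin_val {u : ℕ} (i : Fin u) : Encodable.encode i = (i : ℕ) := rfl

/-- The program's sparse digit list is the sparse code of the digit vector. -/
theorem digitsL_eq_sparseList (u δ α : ℕ) :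
    digitsL u δ α = sparseList ((dig δ u α).mapDomain Encodable.encode) := by
  classical
  set g : ℕ →₀ ℕ := (dig δ u α).mapDomain Encodable.encode with hg
  have hg_lt : ∀ i (h : i < u), g i = α / (2 ^ δ) ^ i % 2 ^ δ := by
    intro i h
    have := Finsupp.mapDomain_apply (f := (Encodable.encode : Fin u → ℕ))
      Encodable.encode_injective (dig δ u α) ⟨i, h⟩
    rw [encode_fin_val] at this
    rw [hg, this, dig_apply]
  have hg_ge : ∀ i, u ≤ i → g i = 0 := by
    intro i h
    apply Finsupp.mapDomain_notin_range
    rintro ⟨j, hj⟩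
    rw [encode_fin_val] at hj
    omega
  have h1 : ((List.range u).map fun i => (i, α / (2 ^ δ) ^ (min i u) % 2 ^ δ)) =
      (List.range u).map fun i => (i, g i) := by
    refine List.map_congr_left fun i hi => ?_
    have hi' := List.mem_range.mp hi
    rw [min_eq_left hi'.le, hg_lt i hi']
  rw [digitsL, h1, List.filter_map]
  have h2 : (List.range u).filter ((fun q : ℕ × ℕ => !decide (q.2 = 0)) ∘ fun i => (i, g i)) =
      g.support.sort (· ≤ ·) := by
    apply List.SortedLT.eq_of_mem_iff
    · exact List.sortedLT_iff_pairwise.2 (List.pairwise_lt_range.filter _)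
    · exact Finset.sortedLT_sort _
    · intro x
      rw [List.mem_filter, List.mem_range, Finset.mem_sort, Finsupp.mem_support_iff]
      constructor
      · rintro ⟨-, hx⟩; simpa using hx
      · intro hx
        refine ⟨?_, by simpa using hx⟩
        by_contra hxu
        exact hx (hg_ge x (not_lt.mp hxu))
  rw [h2]; rfl

/-- The output code of `(n, sparse code of e, a)` is the query word `expCoeffQuery n e a`. -/
theorem eOut_eq_expCoeffQuery {uu : ℕ} (n a : ℕ) (e : Fin uu →₀ ℕ) :
    eOut (n, (sparseList (e.mapDomain Encodable.encode), a)) = expCoeffQuery n e a := by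
  show boolPair (unE n) (boolPair (listE (pairE natE natE) _) (natE a)) =
    boolPair (List.replicate n true) (boolPair (encMonomial e) (Computability.encodeNat a))
  rw [CodeFP.unE_eq_ones, encMonomial, CodeFP.listE_eq, CodeFP.pairE_eq]
  rfl

/-- **Boolean re-encoding.**  From a `P/poly` language answering the multivariate coefficient
queries `expCoeffQuery`, a `P/poly` language answering Tavenas' univariate queries `encUQuery` for
the Kronecker-packed family (advice: the table of `(uᵢ, δᵢ)`; in range it returns the coefficient
bit of the digit vector, out of range it is false). -/
theorem exists_encUQuery_language {u : ℕ → ℕ} (δ : ℕ → ℕ) (hu : IsPBounded u) (hδ : IsPBounded δ)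
    (Q : ∀ n, MvPolynomial (Fin (u n)) ℤ) {L : Language Bool} (hL : L ∈ PPoly)
    (hLQ : ∀ n (e : Fin (u n) →₀ ℕ) a, expCoeffQuery n e a ∈ L ↔ coeffFnBit (Q n) e a = true)
    (hfalse : ∀ n, coeffFnBit (Q n) 0 (2 ^ δ n) = false) :
    ∃ B ∈ PPoly, ∀ n α j, encUQuery n α j ∈ B ↔
      (α < (2 ^ δ n) ^ u n ∧ coeffFnBit (Q n) (dig (δ n) (u n) α) j = true) := by
  classical
  obtain ⟨PB, hPB⟩ := (isPBounded_iff_exists_polynomial_holds _).1 (IsPBounded.add_holds hu hδ)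
  obtain ⟨f, hfFP, hf⟩ := codeFP_tr
  have hT : IsPBounded fun ℓ => (tableCode u δ ℓ).length := by
    have hPB' : IsPBounded fun ℓ => PB.eval ℓ :=
      (isPBounded_iff_exists_polynomial_holds _).2 ⟨PB, fun _ => le_rfl⟩
    refine IsPBounded.mono (IsPBounded.mul_holds (IsPBounded.add_holds IsPBounded.id
      (IsPBounded.const 1)) (IsPBounded.add_holds (IsPBounded.mul_holds (IsPBounded.const 8) hPB')
      (IsPBounded.const 10))) fun ℓ => ?_
    exact length_tableCode_le u δ PB (fun n => le_trans (Nat.le_add_right _ _) (hPB n))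
      (fun n => le_trans (Nat.le_add_left _ _) (hPB n)) ℓ
  obtain ⟨Padv, hPadv⟩ := (isPBounded_iff_exists_polynomial_holds _).1 hT
  refine ⟨{x | boolPair x (tableCode u δ x.length) ∈ f ⁻¹' L}, ?_, ?_⟩
  · exact polyAdvice_PPoly_subset_PPoly ⟨f ⁻¹' L, preimage_mem_PPoly hL hfFP, tableCode u δ,
      Padv, hPadv, fun x => Iff.rfl⟩
  · intro n α j
    have hlen : n ≤ (encUQuery n α j).length := by
      show n ≤ (boolPair (unE n) _).length
      rw [length_boolPair, length_unE]; omega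
    show boolPair (encUQuery n α j) (tableCode u δ (encUQuery n α j).length) ∈ f ⁻¹' L ↔ _
    rw [Set.mem_preimage]
    have hx : boolPair (encUQuery n α j) (tableCode u δ (encUQuery n α j).length) =
        eIn ((n, (α, j)), table u δ (encUQuery n α j).length) := rfl
    have e0 : ([u n, δ n] : List ℕ).getD 0 0 = u n := rfl
    have e1 : ([u n, δ n] : List ℕ).getD 1 0 = δ n := rfl
    rw [hx, hf, tr, table_getD u δ hlen, e0, e1]
    by_cases hα : α < (2 ^ δ n) ^ u n
    · rw [if_pos (decide_eq_true hα), digitsL_eq_sparseList, eOut_eq_expCoeffQuery]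
      exact (hLQ n (dig (δ n) (u n) α) j).trans (by simp [hα])
    · rw [if_neg (by simpa using hα)]
      have h0 : ([] : List (ℕ × ℕ)) =
          sparseList ((0 : Fin (u n) →₀ ℕ).mapDomain Encodable.encode) := by
        rw [Finsupp.mapDomain_zero]; simp [sparseList]
      rw [h0, eOut_eq_expCoeffQuery]
      exact (hLQ n 0 (2 ^ δ n)).trans (by rw [hfalse n]; simp [hα])

end BooleanSide

end Summit.ValiantsHypothesis.ValiantsHypothesis.Theorems.VPBoundarySquareCoeffQueryFP
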